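import Mathlib.Analysis.SpecialFunctions.SmoothTransition
import Literature.MathematicalPhysics.QuantumLattice.GrassmannEffectiveAction
import Literature.MathematicalPhysics.QuantumLattice.HubbardFreePropagator
import HarnessLib

/-!
# Matsubara fields, the seeded free covariance and Salmhofer's scale decomposition (2D Hubbard torus)

Topic `MathematicalPhysics/QuantumLattice`; part of the definition request
`defn-hubbardEffectiveAction` (route HubbardSuperconductivity/AposterioriCapRg, cruxes
CapRgScaleData = stmt-1375, AposterioriOrderCriterion = stmt-1381); the effective action itself is
`HubbardEffectiveAction.lean`.  For the grand-canonical Hubbard Hamiltonian on the torus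
`(ℤ/Lℤ)²` (hopping `1`, chemical potential `μ`) with the `d`-wave pair source `-h(Δ_d + Δ_d†)`
(`dWaveSourceTorus L U μ h`, `DWaveSource.lean`) at inverse temperature `β`, this file sets up the
finite-dimensional Grassmann representation with `2M` Matsubara frequencies
(Benfatto–Giuliani–Mastropietro 2006, §2.1 (2.1)–(2.5); Salmhofer 1998, §2; Salmhofer 1999,
§4.2.4):

* (i) **fields** `ψ̂^±_{k,σ}` labelled by `HubbardFieldIdx L M = ((k, σ), charge)`,
  `k = (ω, k⃗)`, `ω ∈ {π(2n+1)/β : -M ≤ n < M}` (`MatsubaraIdx M = Fin (2M)`, Salmhofer 1999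
  (4.63); `Fin.rev` is `ω ↦ -ω`), `k⃗ ∈ (ℤ/Lℤ)²` (`TorusSite 2 L`, momentum `2πk⃗/L`), generating
  `HubbardGrassmann L M = GrassmannAlgebra ℂ (HubbardFieldIdx L M)`;
* (ii) the **free covariance** `hubbardCovariance` of the seeded quadratic Hamiltonian
  `H₀ - μN - h(Δ_d + Δ_d†)` in Nambu–Gor'kov form: per momentum the `2 × 2` propagator
  `G(k) = (-iω + M(k⃗))⁻¹ = (iω + M(k⃗))/(ω² + ξ² + Δ²)`, `M(k⃗) = [[ξ, Δ],[Δ, -ξ]]`,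
  `ξ = ε_L(k⃗) - μ` (`torusBand`, `ε_L = -2Σcos`), `Δ = hφ_d(k⃗)`, `φ_d = 2√2(cos p₁ - cos p₂)` the
  symbol of `Δ_d = pairField dWaveFormFactor L = Σ_k φ_d(k⃗) c_{k↑}c_{-k↓}` (plane waves
  `c_{k⃗σ} = L⁻¹Σ_x e^{-ik⃗·x}c_{xσ}`), normalised as in BGM (2.2)–(2.3),
  `∫P(dψ) Ψ̂⁻_{k,a}Ψ̂⁺_{k',b} = βL² δ_{kk'} G(k)_{ab}` for the Nambu fields `Ψ̂^∓_{k,1} = ψ̂^∓_{k↑}`,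
  `Ψ̂⁻_{k,2} = ψ̂⁺_{-k↓}`, `Ψ̂⁺_{k,2} = ψ̂⁻_{-k↓}` (`toNambu`); at `h = 0`, `G₁₁ = 1/(-iω + ξ)` is
  BGM's `ĝ(k)` (`nambuPropagator_zero_seed`).  In the convention of `gaussConv_gen_mul_gen`
  (`∫dμ_C ψ_Xψ_Y = ½(C(Y,X) - C(X,Y))`) the matrix is `C(X,Y) = -⟨ψ_Xψ_Y⟩₀`
  (`gaussExpect_hubbardCovariance_gen_mul_gen`);
* (iii) the **scale decomposition** `C = C_{>Λ} + C_{≤Λ}`, `C_{>Λ}(k) = χ₂(Λ⁻²(ω² + ξ²)) C(k)` with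
  Salmhofer's smooth cutoff `χ₂` (`= 0` below `¼`, `= 1` above `1`; Salmhofer 1999 (4.70)–(4.71),
  Salmhofer 1998 Prop. 3, `ε_t = Λ`), realised by `Real.smoothTransition` (`salmhoferCutoff`,
  `hubbardCutoffWeight`, `hubbardCovAbove/Below/Slice`; `hubbardCovAbove_transpose`).

## Main statements (all proved)

`matsubaraFreq_rev`, `matsubaraFreq_ne_zero`, `pi_div_le_abs_matsubaraFreq`; `torusBand_neg`,
`dWaveSymbol_neg`, `hubbardCutoffWeight_neg` (evenness in `k`); `hubbardCovariance_transpose` (antisymmetry), `gaussExpect_hubbardCovariance_gen_mul_gen`,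
`hubbardTwoPoint_psiMinus_psiPlus` (BGM (2.3)); `salmhoferCutoff_of_le/_of_ge/_mem_Icc`,
`contDiff_salmhoferCutoff`; `hubbardCovAbove_add_hubbardCovBelow`, `hubbardCovAbove_eq_slice_add`,
`hubbardCovAbove_eq_of_le` (`0 < Λ ≤ π/β`: temperature is an infrared cutoff),
`hubbardCovAbove_eq_zero_of_weight`.

## Sources

G. Benfatto, A. Giuliani, V. Mastropietro, Ann. Henri Poincaré 7 (2006) 809, §2.1, (2.1)–(2.5)
(arXiv pp. 5–6 of the held copy `paper:arxiv-cond-mat_0507686`); bib key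
`BenfattoGiulianiMastropietro2006`.  M. Salmhofer, Commun. Math. Phys. 194 (1998) 249, §2.1–2.4,
Prop. 3 (arXiv:cond-mat/9706188, held); bib key `Salmhofer1998`.  M. Salmhofer, *Renormalization*
(1999), §4.2.3–4.2.5 (4.53)–(4.71); bib key `Salmhofer1999`.  D. J. Scalapino, Phys. Rep. 250
(1995) 329, §2 (the `B₁g` form factor); bib key `Scalapino1995`.

## Design choices and what is NOT claimed

* Finite `(β, L, M)`, purely algebraic over `ℂ`.  The functional-integral identity
  `Tr e^{-βH}/Tr e^{-βH_quad} = lim_{M→∞} ∫P(dψ) e^{-V}` (BGM (2.6); Salmhofer 1999 (4.53)–(4.54))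
  is NOT asserted (the tree has its equal-time `U = 0` core, `FermionQuasiFreeGrassmann.lean`);
  no fact about the operator `dWaveSourceTorus` is stated here.
* The cutoff compares `|iω - ξ|² = ω² + ξ²` with `Λ²` (Salmhofer (4.70)); the seed enters the
  covariance, not the cutoff.  Junk: `Λ = 0` gives weight `χ₂(0) = 0` (`x/0 = 0`), i.e. `C_{>0} = 0`
  (the full covariance is `C_{>Λ}` for `0 < Λ ≤ π/β`); `β = 0`, `L = 0` give junk values.
-/

noncomputable section

namespace Literature.MathematicalPhysics.QuantumLattice

open Literature.Probability.LatticeModels GrassmannAlgebra Finset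

/-! ### Matsubara frequencies `ω_n = π(2n+1)/β`, `-M ≤ n < M` -/

/-- The index set of the `2M` fermionic Matsubara frequencies kept by the ultraviolet cutoff:
`i : Fin (2M)` stands for `n = i - M ∈ {-M, …, M-1}` (Salmhofer 1999, (4.63); BGM 2006, §2.1).
[cite: Salmhofer1999, §4.2.4 (4.63)] -/
abbrev MatsubaraIdx (M : ℕ) : Type := Fin (2 * M)

/-- The integer `n = i - M ∈ [-M, M)` labelling the frequency `π(2n+1)/β`. [cite: Salmhofer1999, §4.2.4 (4.63)] -/
def matsubaraInt (M : ℕ) (i : MatsubaraIdx M) : ℤ := (i : ℤ) - M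

/-- The fermionic **Matsubara frequency** `ω = π (2n + 1) / β`, `n = i - M`
(Salmhofer 1999, (4.63); BGM 2006, `k₀ = 2π(n₀ + ½)/β`). [cite: Salmhofer1999, §4.2.4 (4.63)] -/
def matsubaraFreq (β : ℝ) (M : ℕ) (i : MatsubaraIdx M) : ℝ :=
  Real.pi * (2 * (matsubaraInt M i : ℝ) + 1) / β

variable {M : ℕ}

/-- `Fin.rev` is `n ↦ -n - 1` on the integer labels. [folklore] -/
theorem matsubaraInt_rev (i : MatsubaraIdx M) : matsubaraInt M i.rev = -matsubaraInt M i - 1 := by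
  simp only [matsubaraInt, Fin.val_rev]
  have hi := i.isLt
  push_cast [Nat.sub_sub, Nat.cast_sub (show (i : ℕ) + 1 ≤ 2 * M by omega)]
  ring

/-- **Frequency reflection**: `ω_{rev i} = -ω_i`; the finite frequency set is symmetric
(Salmhofer 1999, (4.63): `-n_τ/2 ≤ n < n_τ/2`). [folklore] -/
theorem matsubaraFreq_rev (β : ℝ) (i : MatsubaraIdx M) :
    matsubaraFreq β M i.rev = -matsubaraFreq β M i := by
  simp only [matsubaraFreq, matsubaraInt_rev]
  push_cast
  ring

/-- `|2n + 1| ≥ 1` for an integer `n`. [folklore] -/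
theorem one_le_abs_two_mul_add_one (n : ℤ) : (1 : ℝ) ≤ |2 * (n : ℝ) + 1| := by
  rcases le_or_gt 0 n with hn | hn
  · have : (0 : ℝ) ≤ n := by exact_mod_cast hn
    rw [abs_of_nonneg (by linarith)]
    linarith
  · have hn' : n ≤ -1 := by omega
    have : (n : ℝ) ≤ -1 := by exact_mod_cast hn'
    rw [abs_of_neg (by linarith)]
    linarith

/-- **Fermionic Matsubara frequencies do not vanish** (`β ≠ 0`): the reason the free covariance
is invertible at positive temperature (Salmhofer 1998, §2.1–2.2). [folklore] -/
theorem matsubaraFreq_ne_zero {β : ℝ} (hβ : β ≠ 0) (i : MatsubaraIdx M) : matsubaraFreq β M i ≠ 0 := by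
  have h1 := one_le_abs_two_mul_add_one (matsubaraInt M i)
  have h2 : (2 * (matsubaraInt M i : ℝ) + 1) ≠ 0 := fun h => by
    rw [h, abs_zero] at h1
    exact absurd h1 (by norm_num)
  simp only [matsubaraFreq]
  exact div_ne_zero (mul_ne_zero Real.pi_ne_zero h2) hβ

/-- The smallest frequency is `π/β`: `π/β ≤ |ω|` (`0 < β`); temperature is an infrared cutoff
(Salmhofer 1999, §4.2.3). [folklore] -/
theorem pi_div_le_abs_matsubaraFreq {β : ℝ} (hβ : 0 < β) (i : MatsubaraIdx M) :
    Real.pi / β ≤ |matsubaraFreq β M i| := by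
  rw [matsubaraFreq, abs_div, abs_mul, abs_of_pos Real.pi_pos, abs_of_pos hβ]
  exact div_le_div_of_nonneg_right (le_mul_of_one_le_right Real.pi_pos.le
    (one_le_abs_two_mul_add_one _)) hβ.le

/-! ### Field labels: frequency–momentum, spin, charge -/

/-- Frequency–momentum labels `k = (ω, k⃗)`: a Matsubara index and a point of the dual torus
`(ℤ/Lℤ)²` (momentum `p = 2πk⃗/L`, `latticeMomentum`) (BGM 2006, §2.1: `k ∈ 𝒟_{β,L}`). [folklore] -/
abbrev FreqMomentum (L M : ℕ) : Type := MatsubaraIdx M × TorusSite 2 L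

/-- `k ↦ -k = (-ω, -k⃗)`. [folklore] -/
def FreqMomentum.neg {L M : ℕ} (k : FreqMomentum L M) : FreqMomentum L M := (k.1.rev, -k.2)

/-- `-(-k) = k`. [folklore] -/
@[simp] theorem FreqMomentum.neg_neg {L M : ℕ} (k : FreqMomentum L M) : k.neg.neg = k := by
  simp [FreqMomentum.neg, Fin.rev_rev]

/-- The labels of the Grassmann generators `ψ̂^±_{k,σ}`: `((k, σ), c)` with spin `σ : Fin 2`
(`0 = ↑`, `1 = ↓`) and charge `c : Fin 2` (`0 ↦ ψ̂⁺`, `1 ↦ ψ̂⁻`) (BGM 2006, §2.1; Salmhofer 1998,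
§2.4: the charge index `j`). [folklore] -/
abbrev HubbardFieldIdx (L M : ℕ) : Type := (FreqMomentum L M × Fin 2) × Fin 2

/-- The finite-dimensional Grassmann algebra of the Hubbard torus at `2M` Matsubara
frequencies, over `ℂ` (BGM 2006, §2.1). [folklore] -/
abbrev HubbardGrassmann (L M : ℕ) : Type := GrassmannAlgebra ℂ (HubbardFieldIdx L M)

/-- The generator `ψ̂⁺_{k,σ}`. [folklore] -/
def psiPlus {L M : ℕ} (k : FreqMomentum L M) (σ : Fin 2) : HubbardGrassmann L M := gen ℂ ((k, σ), 0)

/-- The generator `ψ̂⁻_{k,σ}`. [folklore] -/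
def psiMinus {L M : ℕ} (k : FreqMomentum L M) (σ : Fin 2) : HubbardGrassmann L M := gen ℂ ((k, σ), 1)

/-! ### One-body data: band, `d`-wave symbol, the Nambu propagator -/

section OneBody

variable (L : ℕ) (M : ℕ)

/-- The **`d_{x²-y²}` symbol** `φ_d(k⃗) = 2√2 (cos p₁ - cos p₂)`, `p = 2πk⃗/L`: in the plane-wave
basis `c_{k⃗σ} = L⁻¹ Σ_x e^{-ik⃗·x} c_{xσ}` the pair field `pairField dWaveFormFactor L`
(`Σ_x Σ_e (g(e)/√2)(c_{x↑}c_{x+e↓} - c_{x↓}c_{x+e↑})`) equals `Σ_{k⃗} φ_d(k⃗) c_{k⃗↑} c_{-k⃗↓}`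
(Scalapino 1995, §2: the `B₁g` gap `∝ cos k_x - cos k_y`). [folklore] -/
def dWaveSymbol (k : TorusSite 2 L) : ℝ :=
  2 * Real.sqrt 2 * (Real.cos (latticeMomentum L k 0) - Real.cos (latticeMomentum L k 1))

/-- The band energy measured from the chemical potential, `ξ(k⃗) = ε_L(k⃗) - μ`,
`ε_L = -2(cos p₁ + cos p₂)` (`torusBand`; BGM 2006 (1.4)). [folklore] -/
def nambuXi (μ : ℝ) (k : TorusSite 2 L) : ℝ := torusBand L k - μ

/-- Momentum reflection does not change the cosines of the lattice momenta:
`cos(2π(-k)_i/L) = cos(2π k_i/L)`. [folklore] -/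
theorem cos_latticeMomentum_neg {d : ℕ} [NeZero L] (k : TorusSite d L) (i : Fin d) :
    Real.cos (latticeMomentum L (-k) i) = Real.cos (latticeMomentum L k i) := by
  simp only [latticeMomentum, Pi.neg_apply, ZMod.neg_val]
  split_ifs with h
  · rw [h, ZMod.val_zero]
  · have hL : (L : ℝ) ≠ 0 := by exact_mod_cast NeZero.ne L
    rw [Nat.cast_sub (ZMod.val_lt _).le,
      show 2 * Real.pi * ((L : ℝ) - ((k i).val : ℕ)) / L = 2 * Real.pi - 2 * Real.pi * ((k i).val : ℕ) / L by
        field_simp,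
      Real.cos_two_pi_sub]

/-- The band is even: `ε_L(-k⃗) = ε_L(k⃗)`. [folklore] -/
theorem torusBand_neg {d : ℕ} [NeZero L] (k : TorusSite d L) : torusBand L (-k) = torusBand L k := by
  simp only [torusBand, cos_latticeMomentum_neg]

/-- The `d`-wave symbol is even: `φ_d(-k⃗) = φ_d(k⃗)`. [folklore] -/
theorem dWaveSymbol_neg [NeZero L] (k : TorusSite 2 L) : dWaveSymbol L (-k) = dWaveSymbol L k := by
  simp only [dWaveSymbol, cos_latticeMomentum_neg]

/-- The BCS denominator `ω² + ξ(k⃗)² + (h φ_d(k⃗))²` (`= -det(-iω + M(k⃗))`). [folklore] -/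
def nambuDen (β μ h : ℝ) (k : FreqMomentum L M) : ℝ :=
  matsubaraFreq β M k.1 ^ 2 + nambuXi L μ k.2 ^ 2 + (h * dWaveSymbol L k.2) ^ 2

/-- The **Nambu (Gor'kov) propagator** of the seeded quadratic Hamiltonian
`Σ_k Ψ†_k M(k⃗) Ψ_k`, `M = [[ξ, hφ_d],[hφ_d, -ξ]]`, in BGM's convention `ĝ = (-ik₀ + ·)⁻¹`:
`G(k) = (-iω + M(k⃗))⁻¹ = (iω + M(k⃗))/(ω² + ξ² + h²φ_d²)`, written out entrywise
(`G₁₁ = (iω + ξ)/den`, `G₂₂ = (iω - ξ)/den`, `G₁₂ = G₂₁ = hφ_d/den`).  At `h = 0`,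
`G₁₁ = 1/(-iω + ξ)` is BGM's free propagator (2.3). [folklore] -/
def nambuPropagator (β μ h : ℝ) (k : FreqMomentum L M) : Matrix (Fin 2) (Fin 2) ℂ :=
  !![(Complex.I * matsubaraFreq β M k.1 + nambuXi L μ k.2) / nambuDen L M β μ h k,
      (h * dWaveSymbol L k.2 : ℝ) / nambuDen L M β μ h k;
    (h * dWaveSymbol L k.2 : ℝ) / nambuDen L M β μ h k,
      (Complex.I * matsubaraFreq β M k.1 - nambuXi L μ k.2) / nambuDen L M β μ h k]

/-- **Without seed the Nambu propagator is BGM's free propagator**: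
`G₁₁(k) = 1/(-iω + ε_L(k⃗) - μ)` at `h = 0` (`β ≠ 0`; BGM 2006, (2.3) `ĝ_k = (-ik₀ + ε₀ - μ)⁻¹`).
[cite: BenfattoGiulianiMastropietro2006, §2.1 (2.3)] -/
theorem nambuPropagator_zero_seed {β : ℝ} (hβ : β ≠ 0) (μ : ℝ) (k : FreqMomentum L M) :
    nambuPropagator L M β μ 0 k 0 0 = 1 / (-Complex.I * matsubaraFreq β M k.1 + nambuXi L μ k.2) := by
  have hω := matsubaraFreq_ne_zero (M := M) hβ k.1
  set ω := matsubaraFreq β M k.1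
  set ξ := nambuXi L μ k.2
  have hden : (-Complex.I * ω + ξ) * (Complex.I * ω + ξ) = ((ω ^ 2 + ξ ^ 2 : ℝ) : ℂ) := by
    push_cast
    ring_nf
    rw [Complex.I_sq]
    ring
  have hne : (-Complex.I * ω + ξ) ≠ 0 := by
    intro h
    have := congrArg Complex.im h
    simp [ω] at this
    exact hω this
  simp only [nambuPropagator, nambuDen, zero_mul, zero_pow two_ne_zero, add_zero,
    Matrix.of_apply, Matrix.cons_val', Matrix.cons_val_zero, Matrix.cons_val_fin_one]
  rw [eq_div_iff hne, div_mul_eq_mul_div, mul_comm, hden, div_self]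
  have hpos : 0 < ω ^ 2 + ξ ^ 2 := by positivity
  exact_mod_cast hpos.ne'

end OneBody

/-! ### The Nambu relabelling and the free covariance -/

section Covariance

variable {L M : ℕ}

/-- The **Nambu relabelling** of the generators: `(k,↑,±) ↦ (k, 1, ±)` and
`(k,↓,+) ↦ (-k, 2, -)`, `(k,↓,-) ↦ (-k, 2, +)` (`Ψ⁻_{k,2} = ψ̂⁺_{-k↓}`, `Ψ⁺_{k,2} = ψ̂⁻_{-k↓}`),
under which the seeded (singlet-pairing) quadratic form is charge conserving. [folklore] -/
def toNambu (X : HubbardFieldIdx L M) : (FreqMomentum L M × Fin 2) × Fin 2 :=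
  if X.1.2 = 0 then X else ((X.1.1.neg, 1), X.2.rev)

/-- The Nambu relabelling is an involution-built bijection: applying it twice is the identity.
[folklore] -/
theorem toNambu_toNambu (X : HubbardFieldIdx L M) : toNambu (toNambu X) = X := by
  obtain ⟨⟨k, σ⟩, c⟩ := X
  by_cases hσ : σ = 0
  · simp [toNambu, hσ]
  · have hσ1 : σ = 1 := by fin_cases σ <;> simp_all
    subst hσ1
    simp [toNambu, Fin.rev_rev]

variable (L M)

/-- The ordered free two-point table in Nambu labels: `⟨Ψ̂⁻_{k,a} Ψ̂⁺_{k',b}⟩ = βL² δ_{kk'} G(k)_{ab}`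
and `0` for the other charge orders (BGM 2006, (2.2)–(2.3), with the seeded `G`). [folklore] -/
def nambuTwoPoint (β μ h : ℝ) (X Y : (FreqMomentum L M × Fin 2) × Fin 2) : ℂ :=
  if X.2 = 1 ∧ Y.2 = 0 ∧ X.1.1 = Y.1.1 then
    ((β * (L : ℝ) ^ 2 : ℝ) : ℂ) * nambuPropagator L M β μ h X.1.1 X.1.2 Y.1.2
  else 0

/-- The **free two-point table** `⟨ψ_X ψ_Y⟩₀` of the seeded Hubbard torus (the intended value
of `∫ P(dψ) ψ_X ψ_Y`, `X` to the left of `Y`): the Nambu table transported along `toNambu` and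
antisymmetrised — normal parts `⟨ψ̂⁻_{k↑}ψ̂⁺_{k↑}⟩ = βL² G₁₁(k)`, `⟨ψ̂⁺_{k↓}ψ̂⁻_{k↓}⟩ = βL² G₂₂(-k)`,
anomalous parts `⟨ψ̂⁻_{k↑}ψ̂⁻_{-k↓}⟩ = βL² G₁₂(k)`, `⟨ψ̂⁺_{k↓}ψ̂⁺_{-k↑}⟩ = βL² G₂₁(-k)`
(BGM 2006, (2.3); Nambu–Gor'kov form of the seed). [folklore] -/
def hubbardTwoPoint (β μ h : ℝ) (X Y : HubbardFieldIdx L M) : ℂ :=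
  nambuTwoPoint L M β μ h (toNambu X) (toNambu Y) - nambuTwoPoint L M β μ h (toNambu Y) (toNambu X)

/-- **The free covariance** of the seeded Hubbard torus, the antisymmetric matrix `C` on field
labels with `∫ dμ_C ψ_X ψ_Y = ⟨ψ_X ψ_Y⟩₀` in the convention of `gaussConv_gen_mul_gen`
(`∫ dμ_C ψ_X ψ_Y = ½(C(Y,X) - C(X,Y))`), i.e. `C(X,Y) = -⟨ψ_X ψ_Y⟩₀` (Salmhofer 1998, §2.4:
`C = A⁻¹` antisymmetric; BGM 2006, (2.2)–(2.3)). [cite: BenfattoGiulianiMastropietro2006, §2.1 (2.2)–(2.3)] -/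
def hubbardCovariance (β μ h : ℝ) : Matrix (HubbardFieldIdx L M) (HubbardFieldIdx L M) ℂ :=
  Matrix.of fun X Y => -hubbardTwoPoint L M β μ h X Y

variable (β μ h : ℝ)

/-- The two-point table is antisymmetric. [folklore] -/
theorem hubbardTwoPoint_swap (X Y : HubbardFieldIdx L M) :
    hubbardTwoPoint L M β μ h Y X = -hubbardTwoPoint L M β μ h X Y := by
  simp only [hubbardTwoPoint]; ring

/-- **The covariance is antisymmetric**, `Cᵀ = -C` (Salmhofer 1998, (3.1)/(4.83)). [folklore] -/
theorem hubbardCovariance_transpose :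
    (hubbardCovariance L M β μ h).transpose = -hubbardCovariance L M β μ h := by
  ext X Y
  simp only [hubbardCovariance, Matrix.transpose_apply, Matrix.of_apply, Matrix.neg_apply,
    hubbardTwoPoint_swap L M β μ h X Y, neg_neg]

/-- **The Gaussian two-point function of `dμ_C` is the free two-point table**:
`∫ dμ_C ψ_X ψ_Y = ⟨ψ_X ψ_Y⟩₀`. [folklore] -/
theorem gaussExpect_hubbardCovariance_gen_mul_gen [NeZero L] (X Y : HubbardFieldIdx L M) :
    gaussExpect ℂ (hubbardCovariance L M β μ h) (gen ℂ X * gen ℂ Y) = hubbardTwoPoint L M β μ h X Y := by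
  rw [gaussExpect_gen_mul_gen, hubbardCovariance, Matrix.of_apply, Matrix.of_apply,
    hubbardTwoPoint_swap L M β μ h X Y]
  simp only [one_div, neg_neg, sub_neg_eq_add, ← two_mul, ← mul_assoc]
  rw [show ((2⁻¹ : ℚ) • (1 : ℂ)) * 2 = 1 by norm_num, one_mul]

/-- **BGM's normalisation (2.3)**: `∫ dμ_C ψ̂⁻_{k↑} ψ̂⁺_{k'↑} = βL² δ_{kk'} G₁₁(k)`. [cite: BenfattoGiulianiMastropietro2006, §2.1 (2.3)] -/
theorem hubbardTwoPoint_psiMinus_psiPlus [NeZero L] (k k' : FreqMomentum L M) :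
    gaussExpect ℂ (hubbardCovariance L M β μ h) (psiMinus k 0 * psiPlus k' 0) =
      if k = k' then ((β * (L : ℝ) ^ 2 : ℝ) : ℂ) * nambuPropagator L M β μ h k 0 0 else 0 := by
  rw [psiMinus, psiPlus, gaussExpect_hubbardCovariance_gen_mul_gen, hubbardTwoPoint]
  simp [toNambu, nambuTwoPoint]

end Covariance

/-! ### Salmhofer's smooth cutoff and the scale decomposition -/

section Cutoff

/-- **Salmhofer's cutoff function `χ₂ = 1 - χ₁`**: smooth, with values in `[0,1]`, `= 0` on
`[0, ¼]` and `= 1` on `[1, ∞)`, nondecreasing (Salmhofer 1999, (4.71); Salmhofer 1998, before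
Prop. 3), here the instance `x ↦ smoothTransition((4x - 1)/3)` built from Mathlib's
`Real.smoothTransition`. [cite: Salmhofer1999, §4.2.5 (4.71)] -/
def salmhoferCutoff (x : ℝ) : ℝ := Real.smoothTransition ((4 * x - 1) / 3)

/-- `χ₂ = 0` below `¼`. [cite: Salmhofer1999, §4.2.5 (4.71)] -/
theorem salmhoferCutoff_of_le {x : ℝ} (hx : x ≤ 1 / 4) : salmhoferCutoff x = 0 :=
  Real.smoothTransition.zero_of_nonpos (by linarith)

/-- `χ₂ = 1` above `1`. [cite: Salmhofer1999, §4.2.5 (4.71)] -/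
theorem salmhoferCutoff_of_ge {x : ℝ} (hx : 1 ≤ x) : salmhoferCutoff x = 1 :=
  Real.smoothTransition.one_of_one_le (by linarith)

/-- `χ₂ ∈ [0, 1]`. [folklore] -/
theorem salmhoferCutoff_mem_Icc (x : ℝ) : salmhoferCutoff x ∈ Set.Icc (0 : ℝ) 1 :=
  ⟨Real.smoothTransition.nonneg _, Real.smoothTransition.le_one _⟩

/-- `χ₂` is smooth. [folklore] -/
theorem contDiff_salmhoferCutoff {n : ℕ∞} : ContDiff ℝ n salmhoferCutoff :=
  Real.smoothTransition.contDiff.comp ((contDiff_const.mul contDiff_id).sub contDiff_const |>.div_const _)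

/-- `χ₂` is nondecreasing. [folklore] -/
theorem monotone_salmhoferCutoff : Monotone salmhoferCutoff := fun _ _ hxy =>
  Real.smoothTransition.monotone (by linarith)

variable (L M : ℕ)

/-- The **weight of the fields above scale `Λ`**: `χ₂(Λ⁻² |iω - ξ(k⃗)|²) = χ₂((ω² + ξ²)/Λ²)`
(Salmhofer 1999, (4.70) with `ε_t = Λ`; `1` well above the scale, `0` well below). [cite: Salmhofer1999, §4.2.5 (4.70)] -/
def hubbardCutoffWeight (β μ Λ : ℝ) (k : FreqMomentum L M) : ℝ :=
  salmhoferCutoff ((matsubaraFreq β M k.1 ^ 2 + nambuXi L μ k.2 ^ 2) / Λ ^ 2)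

/-- The weight is even in `k` (`ω ↦ -ω`, `ε_L` even), so the fields `±k` paired by the seed carry the
same weight. [folklore] -/
theorem hubbardCutoffWeight_neg [NeZero L] (β μ Λ : ℝ) (k : FreqMomentum L M) :
    hubbardCutoffWeight L M β μ Λ k.neg = hubbardCutoffWeight L M β μ Λ k := by
  simp only [hubbardCutoffWeight, FreqMomentum.neg, matsubaraFreq_rev, neg_sq, nambuXi, torusBand_neg]

/-- The frequency–momentum label of a field. [folklore] -/
def momentumOf (X : HubbardFieldIdx L M) : FreqMomentum L M := X.1.1

/-- The **covariance of the fields above scale `Λ`**, `C_{>Λ}(X,Y) = w_Λ C(X,Y)` with the weight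
`w_Λ = χ₂((ω²+ξ²)/Λ²)` (Salmhofer 1999, (4.70): `C_t = C · χ₂(ε_t⁻²|iω̂ - E|²)`), written with the
symmetrised weight `½(w_Λ(k_X) + w_Λ(k_Y))` so that `C_{>Λ}` is manifestly antisymmetric
(`C(X,Y) ≠ 0` only for `k_Y = ±k_X`, where the two weights agree). [cite: Salmhofer1999, §4.2.5 (4.70)] -/
def hubbardCovAbove (β μ h Λ : ℝ) : Matrix (HubbardFieldIdx L M) (HubbardFieldIdx L M) ℂ :=
  Matrix.of fun X Y =>
    (((hubbardCutoffWeight L M β μ Λ (momentumOf L M X) + hubbardCutoffWeight L M β μ Λ (momentumOf L M Y)) / 2 : ℝ) : ℂ) *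
      hubbardCovariance L M β μ h X Y

/-- The **covariance of the fields at and below scale `Λ`**, `C_{≤Λ} = C - C_{>Λ}` (the
unintegrated fields; Salmhofer 1999, after (4.92): `D_t = C - C_t`). [cite: Salmhofer1999, §4.3.2 (after (4.92))] -/
def hubbardCovBelow (β μ h Λ : ℝ) : Matrix (HubbardFieldIdx L M) (HubbardFieldIdx L M) ℂ :=
  hubbardCovariance L M β μ h - hubbardCovAbove L M β μ h Λ

/-- The **slice covariance** between two scales, `C_{(Λ,Λ']} = C_{>Λ} - C_{>Λ'}`. [folklore] -/
def hubbardCovSlice (β μ h Λ Λ' : ℝ) : Matrix (HubbardFieldIdx L M) (HubbardFieldIdx L M) ℂ :=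
  hubbardCovAbove L M β μ h Λ - hubbardCovAbove L M β μ h Λ'

variable (β μ h : ℝ)

/-- `C_{>Λ}` is antisymmetric. [folklore] -/
theorem hubbardCovAbove_transpose (Λ : ℝ) :
    (hubbardCovAbove L M β μ h Λ).transpose = -hubbardCovAbove L M β μ h Λ := by
  ext X Y
  have hC := congrFun (congrFun (hubbardCovariance_transpose L M β μ h) X) Y
  rw [Matrix.transpose_apply, Matrix.neg_apply] at hC
  simp only [hubbardCovAbove, Matrix.transpose_apply, Matrix.of_apply, Matrix.neg_apply, hC, mul_neg,
    add_comm (hubbardCutoffWeight L M β μ Λ (momentumOf L M Y))]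

/-- **Scale decomposition** `C = C_{>Λ} + C_{≤Λ}`. [folklore] -/
theorem hubbardCovAbove_add_hubbardCovBelow (Λ : ℝ) :
    hubbardCovAbove L M β μ h Λ + hubbardCovBelow L M β μ h Λ = hubbardCovariance L M β μ h :=
  add_sub_cancel _ _

/-- `C_{>Λ} = C_{(Λ,Λ']} + C_{>Λ'}`: lowering the infrared scale adds a slice. [folklore] -/
theorem hubbardCovAbove_eq_slice_add (Λ Λ' : ℝ) :
    hubbardCovAbove L M β μ h Λ = hubbardCovSlice L M β μ h Λ Λ' + hubbardCovAbove L M β μ h Λ' :=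
  (sub_add_cancel _ _).symm

/-- **Temperature is an infrared cutoff**: for `0 < Λ ≤ π/β` every field is above scale
(`ω² ≥ (π/β)² ≥ Λ²`), so `C_{>Λ} = C` (Salmhofer 1999, §4.2.3). [folklore] -/
theorem hubbardCovAbove_eq_of_le {β Λ : ℝ} (hβ : 0 < β) (hΛ : 0 < Λ) (hle : Λ ≤ Real.pi / β) (μ h : ℝ) :
    hubbardCovAbove L M β μ h Λ = hubbardCovariance L M β μ h := by
  have hw : ∀ k : FreqMomentum L M, hubbardCutoffWeight L M β μ Λ k = 1 := by
    intro k
    rw [hubbardCutoffWeight, salmhoferCutoff_of_ge]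
    rw [le_div_iff₀ (by positivity), one_mul]
    have h1 : Λ ≤ |matsubaraFreq β M k.1| := hle.trans (pi_div_le_abs_matsubaraFreq hβ _)
    have h2 : Λ ^ 2 ≤ matsubaraFreq β M k.1 ^ 2 := by
      rw [← sq_abs (matsubaraFreq _ _ _)]
      exact pow_le_pow_left₀ hΛ.le h1 2
    nlinarith [sq_nonneg (nambuXi L μ k.2)]
  ext X Y
  rw [hubbardCovAbove, Matrix.of_apply, hw, hw]
  norm_num

/-- If no field is above scale (`χ₂ = 0` at every momentum, e.g. `Λ² > 4 max(ω² + ξ²)`), then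
`C_{>Λ} = 0`. [folklore] -/
theorem hubbardCovAbove_eq_zero_of_weight {β μ Λ : ℝ} (hw : ∀ k, hubbardCutoffWeight L M β μ Λ k = 0) (h : ℝ) :
    hubbardCovAbove L M β μ h Λ = 0 := by
  ext X Y
  rw [hubbardCovAbove, Matrix.of_apply, hw, hw, Matrix.zero_apply]
  norm_num

end Cutoff

end Literature.MathematicalPhysics.QuantumLattice
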